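import Summits.BirchSwinnertonDyer.Rank1Residual.F1Sign2.TwoAdicBSDRankOneAtTwo
import Summits.BirchSwinnertonDyer.Rank1Residual.F1Sign2.KatzFrobeniusColumn
import Summits.BirchSwinnertonDyer.Rank1Residual.F1Sign2.TwoAdicBSDRankOneSsAtTwo
import Literature.NumberTheory.EllipticCurves.FormalGroup
import Literature.NumberTheory.EllipticCurves.Kato2004.LocPKummerLog
import Literature.NumberTheory.EllipticCurves.BSDQuadraticDescentTorsionOddPartProofs
import HarnessLib

/-!
# Cell `bsd-f1-sign2`, lens `-es` g8 (MEMO-es §17): the 2-adic BSD formula at a SUPERSINGULAR 2 in rank one as an EXACT identity in `ℚ₂` —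
# rows ES-17-Xss `TwoAdicBSDEtaExactRankOneSs` (crux-slice candidate), ES-17-Xss± `TwoAdicBSDEtaExactUpToSignRankOneSs`, ES-17-Vfin
# `TwoAdicBSDEtaValFinRankOneSs`, ES-17-Iso `TwoAdicEtaIsogenyRatioRankOneSs` (support, print-reducible), glue ES-17-G (PROVED)

SIBLING MODULE of the landed `F1Sign2/TwoAdicBSDRankOneSsAtTwo.lean` (p621777; ES-16 receptacles `frobMatrixOmegaBasis`, `logOmegaAt`, `IsSsLDerivVector`,
`ssLeadingEta`, rows K2-Vss/Tss and the halves are used BY NAME — nothing copied): -es asked for an APPEND §«exact law» to that module, which is at 394/400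
lines, so the block lives here (the alternative name -es offered).  STATEMENTS: four `@[conjecture] def … : Prop` (nothing asserted) + the helper
`ssLeadingFomega` (the `Fω`-coordinate `B` of the DES engines; `ssLeadingEta_eq : ssLeadingEta W p L v = v * ssLeadingFomega W p L` by `rfl`) + PROVED
glue (`exactUpToSign_of_exact`, `norm_natCard_eq_norm_natCard_primaryComponent`, `valFin_of_exactUpToSign`, `valFin_of_exact`, `valFin_of_val`,
`frobMatrixOmegaBasis_congr`, `isSsLDerivVector_congr`, `iso_of_exact`, `Glue17Ss`/`glue17Ss`, `rankOneAtTwoSs_of_exact`; standard axioms per -es).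
No `instance`, no `notation`, no Literature fact, no `sorry`.

TYPER FILING (seat `bsd-f1-sign2-ty`, drafted g8 as bc34ed447badf63e, filed g9 after REF1 §93 cleared the gate D-ty-ref1-17 at 2026-08-28T10:43:26Z;
CANDIDATES.md rows ES-17-Xss/Xss±/Vfin/Iso/G; -es g8 CANDIDATES-delta 2026-08-28T10:18:29Z, MEMO-es §17.8):
body VERBATIM from `HOME/data-es/g8/Sketch17T.lean` dc5db1d76c62abf6 l.31–263 (-es: rc 0 · 0 sorry · 0 warn; BC7 Probe17T 4/4 CLEAN
`data-es/g8/Probe17T.txt`) — builder `tools/mk_es17.py` (published with the filed text under `HOME/MEMO-ty-data/g8/`); typer edits = this header,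
one docstring added (`ssLeadingEta_eq`), the PLACEMENT paragraph (§17.7 bullet 1), the REF1, REF2 verdict paragraphs in the K2-Xss docstring and REF1's
riders r2 (K2-IsoSs: Faltings; `hap` redundant) and r3 (K2-Vss-fin: `plusPeriod f ≠ 0`) as single docstring sentences; statements byte-identical to the sketch.
REF1-AUDIT §93 (g9, 2026-08-28; FILING GATE D-ty-ref1-17 CLEARED 10:43:26Z): SURVIVES, conjecture-grade, CLEARED as typed (A1 rc 0 · 0 sorry · axioms trio on all
glue; A2 faithful to BPR 1993 = Sprung 2015 Conj. 4.7/1.2 [arXiv:1512.09362 p. 7; `h′_ω = −log²_ω` p. 6] modulo r1; BC7: η-channel census recomputed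
independently from the raw job outputs 75/75, Ш_an = 9 rows ≡ 9 (mod 32) 11/11, partners ≡ 1 20/20, F1 not fired under three-level trust, four bit-7 rows
referred to D-ref1-es-17a). Riders: r1 the sign «−» is the engines' (PARI `D`-height η-coordinate + eclib/PARI symbol orientation, DES16 D4 / DES17 F2
74/74) under the dictionary `x⁺_engine = c_∞ϖ·x⁺_typed` — the orientation-free face is `TwoAdicBSDEtaExactUpToSignRankOneSs`; r3 the row entails
`plusPeriod f ≠ 0` (REF1 e2′) = named fact `IsNewform0.plusPeriod_pos`. Kernel: e1 (sign is content), e2/e2′ (junk branch), e5 (basis-independence) in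
`HOME/REF1-data/b93/Probe93.lean` 0470616630459070.
REF2-PLACEMENT v24 §6 (45974357b6e499b5, 2026-08-28T10:27:47Z): formulation PRINT (BPR 1993 ⟺ Sprung 2015 Conj 1.2, p = 2 included; Sprung 2012 L♯/L♭ at 2
[arXiv:1211.1352 p. 7, p. 11]) ⇒ known-as-conjecture, η-exact typing; numerical test below v₂ at p = 2 not found in print (PR 2003 §6 odd p; Stein–Wuthrich
2013 «exclude p = 2»; Kurihara–Pollack 2007 / Balakrishnan–Müller–Stein 2016 odd p; Sprung 2015 §3 odd p) — rider: BPR93's own announced numerical example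
is unverified here until acq-13909 lands (if it is a p = 2 example, read «beyond BPR 1993's example»; no grade consequence); K2-IsoSs print-reducible
(Cassels 1965; Milne ADT I Thm 7.3; tree `WeierstrassCurve.bsdRHS_eq_of_isIsogenous`); CERT lane = standard published algorithms, new in range only;
beyond-print theorem no; beyond-print test yes; PARTITION none.
CENSUS / BC5 (-es g8 DES17, `HOME/data-es/des17/`; MEMO-es §17.5–§17.6): K2-Xss EXACT — `Se5 = #Ш_an` to every conservatively trusted `2`-adic bit on
74/74 converged EXT rows (68/68 with ≥ 4 trusted bits; 0 stable deviations; `#Ш_an = 9` rows ≡ 9 (mod 32) 11/11), second engine X1P 12/12; sign F2: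
unit ≡ +1 on 74/74 (`Se5 = +Ш_an`, i.e. `ϖ·Λ_η·T² = −#Ш·Tam·log_ω(P₀)²` with the tree's plain formal log — the typed `-(…)` is the data's sign); ISO
23/23 pairs exact at 9 bits; CERT lane 0/283 contradictions (three-engine `Ш[2^∞]` certificates at 35 083 ≤ N ≤ 98 033).  Cheapest falsifier F1 (one
converged row with a stable `2`-adic digit of `Se5` ≠ `#Ш_an`): 0/74 → NOT KILLED; residual exposure 11 rows with `k_c ≤ 4` (D-es-17a, kit j305699).
PARTITION: none moved; beyond-print theorem: no (K2-Xss conjecture-grade; K2-IsoSs print-reducible; certificates are computations); beyond-print TEST: yes.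
bears_on: crux stmt-BirchSwinnertonDyer-23715 (`RankOneAtTwoBigImageOddLocal`, supersingular third of the good half: `rankOneAtTwoSs_of_exact`).

Planner's summary (verbatim, -es g8 Sketch17T module docstring):
# Sketch17 (-es g8, cell bsd-f1-sign2) — the 2-adic BSD formula at a SUPERSINGULAR 2 in rank one as an EXACT identity in `ℚ₂`
(v2: rebased on the TREE module `F1Sign2/TwoAdicBSDRankOneSsAtTwo.lean`, p621777 — receptacles `frobMatrixOmegaBasis`, `logOmegaAt`,
`IsSsLDerivVector`, `ssLeadingEta`, and K2-Vss / K2-Tss / `RankOneAtTwoBigImageOddLocalSs` are used BY NAME from the tree; nothing copied.)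

MEMO-es §17.  New here (all in the parent namespace `…F1Sign2`, names fresh):

* **K2-Xss** `TwoAdicBSDEtaExactRankOneSs` — the η-channel of the `D`-valued 2-adic BSD formula (Bernardi–Perrin-Riou 1993; Sprung 2015
  Conj. 1.2 as printed covers every good supersingular `p`, `p = 2` included) at a good supersingular `2`, `r_an = 1`, as an EQUALITY in `ℚ₂`
  with the sign pinned: `ϖ · Λ_η · #tors² = − #Ш · Tam · log_ω(P₀)²`, `Λ_η = ssLeadingEta W 2 L v`.  It sees what no valuation law sees:
  the unit `Se/#Ш_an ≡ 1` to every computed 2-adic digit — the ODD part of `#Ш` (`#Ш_an = 9` classes), the sign, odd Tam / `#tors²`, `ϖ`.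
* **K2-Xss±** `TwoAdicBSDEtaExactUpToSignRankOneSs` — the same up to `ε ∈ {1, −1}`.
* **K2-Vss-fin** `TwoAdicBSDEtaValFinRankOneSs` — tree K2-Vss with `Finite (Ш[2^∞])` strengthened to `Finite Ш` and `#Ш` on the right
  (equal in `‖·‖₂`); all the glue chain ever uses, since Kolyvagin supplies `Finite Ш`.
* **K2-IsoSs** `TwoAdicEtaIsogenyRatioRankOneSs` — the `L`-FREE consequence across an isogeny class (same newform, same `a₂`):
  `ϖ v T² · (#Ш' Tam' log'²) = ϖ' v' T'² · (#Ш Tam log²)`; on paper a THEOREM (Cassels 1965 + functoriality of `ĥ`, `log_ω` and of the Katz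
  column: `v'/v = c/ĉ`, `cĉ = deg φ`); typed `@[conjecture]` for want of those facts in the tree; its census is an engine/convention test.
* PROVED glue (std axioms): `exactUpToSign_of_exact`, `valFin_of_exactUpToSign`, `valFin_of_exact`, `valFin_of_val`, `iso_of_exact`
  (`linear_combination`), `glue17Ss : Glue17Ss` (= tree `glue16Ss` with K2-Vss-fin in place of K2-Vss), `rankOneAtTwoSs_of_exact`.
No `sorry`, no new axioms.  Census: DES17 (MEMO-es §17, HOME/data-es/des17/).
-/

namespace Summit.BirchSwinnertonDyer.Rank1Residual.F1Sign2

open Literature Literature.NumberTheory.EllipticCurves Literature.NumberTheory.EllipticCurves.ModularForms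
open WeierstrassCurve PowerSeries Filter
open scoped Classical MatrixGroups ModularForm Topology
open CongruenceSubgroup

/-! ## One helper name (the `Fω`-coordinate `B` of the DES engines; tree `ssLeadingEta W p L v = v * B` by `rfl`) -/

/-- The `Fω`-coordinate of the normalised leading vector `(1 − p⁻¹Φ)⁻² L` (the `B` of the DES engines). -/
noncomputable def ssLeadingFomega (W : WeierstrassCurve ℚ) [W.IsGloballyMinimal] (p : ℕ) [Fact p.Prime]
    (L : Fin 2 → ℚ_[p]) : ℚ_[p] :=
  Matrix.mulVec ((1 - (p : ℚ_[p])⁻¹ • frobMatrixOmegaBasis W p)⁻¹ ^ 2) L 1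

/-- The tree's `ssLeadingEta W p L v` is `v * ssLeadingFomega W p L` (by `rfl`). -/
theorem ssLeadingEta_eq (W : WeierstrassCurve ℚ) [W.IsGloballyMinimal] (p : ℕ) [Fact p.Prime]
    (L : Fin 2 → ℚ_[p]) (v : ℚ_[p]) : ssLeadingEta W p L v = v * ssLeadingFomega W p L := rfl

/-- **K2-Vss-fin**: K2-Vss with the finiteness hypothesis strengthened to `Finite Ш` (all the §16/§17 glue uses, since Kolyvagin
gives `Finite Ш` in analytic rank one).  Implied by K2-Vss (`valFin_of_val`) and by K2-Xss (`valFin_of_exact`).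
REF1 §93 r3: like K2-Xss (and the landed K2-Vss, K2-Tss) the row silently entails `plusPeriod f ≠ 0` — the junk branch `plusPeriod f = 0` would make
`ϖ = 0` admissible — which is the Literature named fact `IsNewform0.plusPeriod_pos` (Cremona §2.8), print-excluded, not a defect. -/
@[conjecture] def TwoAdicBSDEtaValFinRankOneSs : Prop :=
  ∀ (W : WeierstrassCurve ℚ) [W.IsElliptic] [W.IsGloballyMinimal],
    SliceAtTwo W → W.HasGoodReductionAtPrime 2 → ¬ IsOrdinaryAt W 2 → W.analyticRank = 1 →
    ∀ ⦃N : ℕ⦄ [NeZero N] (f : CuspForm (Gamma0 N) 2), IsNewformOf W f →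
    ∀ L : Fin 2 → ℚ_[2], IsSsLDerivVector W 2 f L →
    ∀ u v : ℚ_[2], IsKatzFrobeniusColumn W 2 u v →
    ∀ P : Fin 1 → W.toAffine.Point, IsMordellWeilBasis P →
      Finite W.sha →
      ∀ ϖ : ℚ, (ϖ : ℝ) * W.realPeriodRat = plusPeriod f →
        ‖(ϖ : ℚ_[2]) * ssLeadingEta W 2 L v * (W.torsionOrder : ℚ_[2]) ^ 2‖ =
          ‖(Nat.card (AddCommGroup.primaryComponent W.sha 2) : ℚ_[2]) * (logOmegaAt W 2 (P 0)) ^ 2 *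
              W.tamagawaProduct‖

/-! ## §17 candidates -/

/-- **K2-Xss (exact η-channel law, sign pinned; conjecture-grade = Bernardi–Perrin-Riou 1993 `D`-valued BSD at `p = 2`, rank 1, η-part,
as an identity in `ℚ₂`).**  On the 23715 slice, good supersingular at `2`, `r_an = 1`: for every newform `f` of `W`, every `D`-valued
`L`-derivative vector `L`, every Katz column `(u,v)`, every Mordell–Weil basis `P` of size one, if `Ш` is finite and `ϖ` is the period ratio
(`ϖ · Ω(W) = Ω⁺_f`) then `ϖ · Λ_η · #tors² = − #Ш · Tam · log_ω(P₀)²` in `ℚ₂` (`Λ_η = ssLeadingEta W 2 L v`).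
Conventions that fix the sign: `[0]⁺_f = L(f,1)/Ω⁺_f ≥ 0` (tree `ratPlusSymbol`), `re Λ_f = ℤ·Ω⁺_f/2`, Katz column `Fω = uω + vη` with
`η = x·ω`; DES16 D4: PARI's `D`-height η-coordinate is `g = −log_ω(P)²` on 21/21 rows, and `T1: B·v_F = Ш_an·g` holds on 900 + 601 rows
(g7) — i.e. the sign `−` is the measured one.  DES17 tests the digits beyond `v₂`: `Se := −ϖΛ_η T²/(Tam·log²) ≡ #Ш_an (mod 2^k)`, decisive on
the `#Ш_an = 9` classes (`9 ≢ 1 mod 16`).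
Why it might fail: a normalisation not pinned in print at `p = 2` (Manin constant of the optimal curve, `Ω` vs `Ω⁺`, the `D`-valued
height's η-normalisation) would show as a constant unit factor `≠ 1`; a non-optimal class member could expose a lattice-index factor.
PLACEMENT (-es MEMO-es §17.7, bullet 1): FORMULATION = PRINT — the `D`-valued supersingular `p`-adic BSD (Bernardi–Perrin-Riou 1993, CRAS 317; not
held, acq-13909) is equivalent to Sprung's tandem ♯/♭ conjecture (Sprung 2015 Conj. 1.2 «p a prime of good supersingular reduction», Thm 1.3, and the
`p = 2` rank criterion; the companion arXiv 1211.1352 builds `L♯, L♭` at `p = 2` explicitly); this row is the η-coordinate of that conjecture at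
`p = 2` in rank one with the tree's normalisations — a typing, not a new conjecture.  WHY NOVEL (-es, one sentence): no printed computation tests any
`p`-adic BSD formula at `p = 2` below the `2`-adic valuation, and none at any supersingular `p` against curves with `#Ш_an ∉ {1}` at `p = 2`; DES17 does
both (odd `Ш_an = 9` to `k ≥ 4` digits, `Ш_an = 4` with certified `Ш[2^∞]`) on 75 rows outside the printed BSD₂ range `N ≤ 5 000` (Stein–Wuthrich
exclude `p = 2` by design; Sprung's leading-term theorem-side statements are for odd `p`).  BARRIERS: `IwasawaTheoryAtTwo` — a leading-term identity at
the trivial character, outside the main-conjecture technique class (its PROOF would re-enter it through K2-Kss/K2-Lss); `PAdicHeightNondegeneracy` absent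
in the η-channel.  Beyond-print THEOREM: no (conjecture-grade); beyond-print TEST: yes.
REF1-AUDIT §93 (g9, 2026-08-28; FILING GATE D-ty-ref1-17 CLEARED 10:43:26Z): SURVIVES, conjecture-grade, CLEARED as typed (A1 rc 0 · 0 sorry · axioms trio on all
glue; A2 faithful to BPR 1993 = Sprung 2015 Conj. 4.7/1.2 [arXiv:1512.09362 p. 7; `h′_ω = −log²_ω` p. 6] modulo r1; BC7: η-channel census recomputed
independently from the raw job outputs 75/75, Ш_an = 9 rows ≡ 9 (mod 32) 11/11, partners ≡ 1 20/20, F1 not fired under three-level trust, four bit-7 rows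
referred to D-ref1-es-17a). Riders: r1 the sign «−» is the engines' (PARI `D`-height η-coordinate + eclib/PARI symbol orientation, DES16 D4 / DES17 F2
74/74) under the dictionary `x⁺_engine = c_∞ϖ·x⁺_typed` — the orientation-free face is `TwoAdicBSDEtaExactUpToSignRankOneSs`; r3 the row entails
`plusPeriod f ≠ 0` (REF1 e2′) = named fact `IsNewform0.plusPeriod_pos`. Kernel: e1 (sign is content), e2/e2′ (junk branch), e5 (basis-independence) in
`HOME/REF1-data/b93/Probe93.lean` 0470616630459070.
REF2-PLACEMENT v24 §6 (45974357b6e499b5, 2026-08-28T10:27:47Z): formulation PRINT (BPR 1993 ⟺ Sprung 2015 Conj 1.2, p = 2 included; Sprung 2012 L♯/L♭ at 2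
[arXiv:1211.1352 p. 7, p. 11]) ⇒ known-as-conjecture, η-exact typing; numerical test below v₂ at p = 2 not found in print (PR 2003 §6 odd p; Stein–Wuthrich
2013 «exclude p = 2»; Kurihara–Pollack 2007 / Balakrishnan–Müller–Stein 2016 odd p; Sprung 2015 §3 odd p) — rider: BPR93's own announced numerical example
is unverified here until acq-13909 lands (if it is a p = 2 example, read «beyond BPR 1993's example»; no grade consequence); K2-IsoSs print-reducible
(Cassels 1965; Milne ADT I Thm 7.3; tree `WeierstrassCurve.bsdRHS_eq_of_isIsogenous`); CERT lane = standard published algorithms, new in range only;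
beyond-print theorem no; beyond-print test yes; PARTITION none.
[cite: BernardiPerrinRiou1993] [cite: Sprung2015, Conj. 1.2, Thm. 1.3] [cite: KuriharaPollack2007, (9)–(11)] -/
@[conjecture] def TwoAdicBSDEtaExactRankOneSs : Prop :=
  ∀ (W : WeierstrassCurve ℚ) [W.IsElliptic] [W.IsGloballyMinimal],
    SliceAtTwo W → W.HasGoodReductionAtPrime 2 → ¬ IsOrdinaryAt W 2 → W.analyticRank = 1 →
    ∀ ⦃N : ℕ⦄ [NeZero N] (f : CuspForm (Gamma0 N) 2), IsNewformOf W f →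
    ∀ L : Fin 2 → ℚ_[2], IsSsLDerivVector W 2 f L →
    ∀ u v : ℚ_[2], IsKatzFrobeniusColumn W 2 u v →
    ∀ P : Fin 1 → W.toAffine.Point, IsMordellWeilBasis P →
      Finite W.sha →
      ∀ ϖ : ℚ, (ϖ : ℝ) * W.realPeriodRat = plusPeriod f →
        (ϖ : ℚ_[2]) * ssLeadingEta W 2 L v * (W.torsionOrder : ℚ_[2]) ^ 2 =
          -((Nat.card W.sha : ℚ_[2]) * (logOmegaAt W 2 (P 0)) ^ 2 * W.tamagawaProduct)

/-- **K2-Xss± (exact η-channel law up to sign).** Same binders; conclusion `∃ ε ∈ {1, −1}, ϖ · Λ_η · #tors² = ε · #Ш · Tam · log_ω(P₀)²`.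
The orientation-robust form (independent of the sign conventions of the plus symbol and of `η`). -/
@[conjecture] def TwoAdicBSDEtaExactUpToSignRankOneSs : Prop :=
  ∀ (W : WeierstrassCurve ℚ) [W.IsElliptic] [W.IsGloballyMinimal],
    SliceAtTwo W → W.HasGoodReductionAtPrime 2 → ¬ IsOrdinaryAt W 2 → W.analyticRank = 1 →
    ∀ ⦃N : ℕ⦄ [NeZero N] (f : CuspForm (Gamma0 N) 2), IsNewformOf W f →
    ∀ L : Fin 2 → ℚ_[2], IsSsLDerivVector W 2 f L →
    ∀ u v : ℚ_[2], IsKatzFrobeniusColumn W 2 u v →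
    ∀ P : Fin 1 → W.toAffine.Point, IsMordellWeilBasis P →
      Finite W.sha →
      ∀ ϖ : ℚ, (ϖ : ℝ) * W.realPeriodRat = plusPeriod f →
        ∃ ε : ℚ_[2], (ε = 1 ∨ ε = -1) ∧
          (ϖ : ℚ_[2]) * ssLeadingEta W 2 L v * (W.torsionOrder : ℚ_[2]) ^ 2 =
            ε * ((Nat.card W.sha : ℚ_[2]) * (logOmegaAt W 2 (P 0)) ^ 2 * W.tamagawaProduct)

/-- **K2-IsoSs (the `L`-free exact law across an isogeny class).**  For `W, W'` both on the slice, good supersingular at `2`, `r_an = 1`,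
with the same `a₂` and the SAME newform `f` (i.e. isogenous), every `D`-valued `L`-vector `L` of `(W, f)`, Katz columns `(u,v)`, `(u',v')`,
Mordell–Weil bases `P`, `P'`, finite `Ш`'s and period ratios `ϖ, ϖ'`:
`ϖ · v · T² · (#Ш' · Tam' · log'(P'₀)²) = ϖ' · v' · T'² · (#Ш · Tam · log(P₀)²)` in `ℚ₂`.
Every factor is algebraic or formal-group-theoretic (no `L`-function); the odd invariants (`3`-power torsion, Tamagawa `9, 81`, `#Ш = 9`,
the isogeny's pull-back constant on `ω`, the real-lattice index) must balance EXACTLY, not just in `v₂`.  Consequence of K2-Xss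
(`iso_of_exact`, PROVED); on paper a theorem (Cassels 1965 + functoriality of `ĥ`, `log_ω`, and `v' / v = c²/deg φ` for the Katz column).
Why it might fail: as a typed statement it inherits every receptacle convention (which curve's `η`; `ϖ` per member); a class where the
optimal curve is not the `Ш_an = 1` member, or Manin constant `≠ 1`, would expose a missing factor.
REF1 §93 (r2): SURVIVES as typed; print-reducible = FALTINGS (same newform ⇒ isogenous — the binders give `IsIsogenous W W'` only through it) +
Cassels 1965 (tree named fact `WeierstrassCurve.bsdRHS_eq_of_isIsogenous`) + functoriality of `ĥ`, `log_ω`, and `v′/v = c/ĉ` (Dieudonné) — derivation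
checked; the hypothesis `W.frobeniusTrace 2 = W'.frobeniusTrace 2` is implied by the two `IsNewformOf` hypotheses at good `2` (REF1 e4,
`WeierstrassCurve.LFunction_apply_prime_eq_frobeniusTrace`) and is kept only because `isSsLDerivVector_congr` consumes it by name.
REF2 v24 §6: print-reducible (Cassels 1965; Milne ADT I Thm 7.3); label «support, print-reducible, not a crux» confirmed. -/
@[conjecture] def TwoAdicEtaIsogenyRatioRankOneSs : Prop :=
  ∀ (W W' : WeierstrassCurve ℚ) [W.IsElliptic] [W.IsGloballyMinimal] [W'.IsElliptic] [W'.IsGloballyMinimal],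
    SliceAtTwo W → SliceAtTwo W' → W.HasGoodReductionAtPrime 2 → W'.HasGoodReductionAtPrime 2 →
    ¬ IsOrdinaryAt W 2 → ¬ IsOrdinaryAt W' 2 → W.analyticRank = 1 → W'.analyticRank = 1 →
    W.frobeniusTrace 2 = W'.frobeniusTrace 2 →
    ∀ ⦃N : ℕ⦄ [NeZero N] (f : CuspForm (Gamma0 N) 2), IsNewformOf W f → IsNewformOf W' f →
    ∀ L : Fin 2 → ℚ_[2], IsSsLDerivVector W 2 f L →
    ∀ u v u' v' : ℚ_[2], IsKatzFrobeniusColumn W 2 u v → IsKatzFrobeniusColumn W' 2 u' v' →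
    ∀ (P : Fin 1 → W.toAffine.Point) (P' : Fin 1 → W'.toAffine.Point), IsMordellWeilBasis P → IsMordellWeilBasis P' →
      Finite W.sha → Finite W'.sha →
      ∀ ϖ ϖ' : ℚ, (ϖ : ℝ) * W.realPeriodRat = plusPeriod f → (ϖ' : ℝ) * W'.realPeriodRat = plusPeriod f →
        (ϖ : ℚ_[2]) * v * (W.torsionOrder : ℚ_[2]) ^ 2 *
            ((Nat.card W'.sha : ℚ_[2]) * (logOmegaAt W' 2 (P' 0)) ^ 2 * W'.tamagawaProduct) =
          (ϖ' : ℚ_[2]) * v' * (W'.torsionOrder : ℚ_[2]) ^ 2 *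
            ((Nat.card W.sha : ℚ_[2]) * (logOmegaAt W 2 (P 0)) ^ 2 * W.tamagawaProduct)

/-! ## Glue (PROVED) -/

/-- K2-Xss ⇒ K2-Xss±. -/
theorem exactUpToSign_of_exact (h : TwoAdicBSDEtaExactRankOneSs) : TwoAdicBSDEtaExactUpToSignRankOneSs := by
  intro W _ _ hS hgood hss hr1 N _ f hf L hLL u v huv P hP hfin ϖ hϖ
  exact ⟨-1, Or.inr rfl, by rw [h W hS hgood hss hr1 f hf L hLL u v huv P hP hfin ϖ hϖ]; ring⟩

/-- `‖(#A : ℚ_p)‖ = ‖(#A[p^∞] : ℚ_p)‖` for a finite abelian group (the prime-to-`p` part is a `p`-adic unit). -/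
theorem norm_natCard_eq_norm_natCard_primaryComponent (A : Type*) [AddCommGroup A] [Finite A] (p : ℕ) [Fact p.Prime] :
    ‖((Nat.card A : ℕ) : ℚ_[p])‖ = ‖((Nat.card (AddCommGroup.primaryComponent A p) : ℕ) : ℚ_[p])‖ := by
  rw [Literature.NumberTheory.EllipticCurves.natCard_primaryComponent_eq_pow_padicValNat p]
  have hp : p ≠ 0 := (Fact.out : p.Prime).ne_zero
  have h0 : Nat.card A ≠ 0 := Nat.card_pos.ne'
  have h0' : ((Nat.card A : ℕ) : ℚ_[p]) ≠ 0 := by exact_mod_cast h0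
  have h1' : ((p ^ padicValNat p (Nat.card A) : ℕ) : ℚ_[p]) ≠ 0 := by exact_mod_cast pow_ne_zero _ hp
  rw [Padic.norm_eq_zpow_neg_valuation h0', Padic.norm_eq_zpow_neg_valuation h1', Padic.valuation_natCast,
    Padic.valuation_natCast, padicValNat.prime_pow]

/-- K2-Xss± ⇒ K2-Vss-fin (norms: `‖ε‖ = 1`, `‖#Ш‖₂ = ‖#Ш[2^∞]‖₂`). -/
theorem valFin_of_exactUpToSign (h : TwoAdicBSDEtaExactUpToSignRankOneSs) : TwoAdicBSDEtaValFinRankOneSs := by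
  intro W _ _ hS hgood hss hr1 N _ f hf L hLL u v huv P hP hfin ϖ hϖ
  haveI := hfin
  obtain ⟨ε, hε, hEq⟩ := h W hS hgood hss hr1 f hf L hLL u v huv P hP hfin ϖ hϖ
  have hεn : ‖ε‖ = 1 := by rcases hε with rfl | rfl <;> simp
  rw [hEq]
  simp only [norm_mul, hεn, one_mul, norm_natCard_eq_norm_natCard_primaryComponent W.sha 2]

/-- K2-Xss ⇒ K2-Vss-fin. -/
theorem valFin_of_exact (h : TwoAdicBSDEtaExactRankOneSs) : TwoAdicBSDEtaValFinRankOneSs :=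
  valFin_of_exactUpToSign (exactUpToSign_of_exact h)

/-- K2-Vss ⇒ K2-Vss-fin (a finite group has finite `p`-primary part). -/
theorem valFin_of_val (h : TwoAdicBSDEtaValRankOneSs) : TwoAdicBSDEtaValFinRankOneSs := by
  intro W _ _ hS hgood hss hr1 N _ f hf L hLL u v huv P hP hfin ϖ hϖ
  haveI := hfin
  exact h W hS hgood hss hr1 f hf L hLL u v huv P hP inferInstance ϖ hϖ

/-- The crystalline Frobenius matrix receptacle `frobMatrixOmegaBasis W p = !![0, -p; 1, a_p]` depends on `W` only through `a_p`. -/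
theorem frobMatrixOmegaBasis_congr {W W' : WeierstrassCurve ℚ} [W.IsGloballyMinimal] [W'.IsGloballyMinimal]
    {p : ℕ} [Fact p.Prime] (h : W.frobeniusTrace p = W'.frobeniusTrace p) :
    frobMatrixOmegaBasis W p = frobMatrixOmegaBasis W' p := by
  simp [frobMatrixOmegaBasis, h]

/-- The `D`-valued `L`-vector receptacle depends on `W` only through `a_p` (and on `f`). -/
theorem isSsLDerivVector_congr {W W' : WeierstrassCurve ℚ} [W.IsGloballyMinimal] [W'.IsGloballyMinimal]
    {p : ℕ} [Fact p.Prime] (h : W.frobeniusTrace p = W'.frobeniusTrace p) {N : ℕ} {f : CuspForm (Gamma0 N) 2}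
    {L : Fin 2 → ℚ_[p]} (hL : IsSsLDerivVector W p f L) : IsSsLDerivVector W' p f L := by
  have e : ssLDerivRiemannSum W' p f = ssLDerivRiemannSum W p f := by
    funext n
    simp only [ssLDerivRiemannSum, ssMeasure, frobMatrixOmegaBasis_congr h]
  unfold IsSsLDerivVector
  rw [e]
  exact hL

/-- **K2-Xss ⇒ K2-IsoSs (PROVED).** Two instances of the exact law with the same `L` (legitimate: the receptacle only sees `a₂` and `f`);
the common analytic factor `B = ((1 − ½Φ)⁻² L)_{Fω}` cancels by cross-multiplication (no non-vanishing needed). -/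
theorem iso_of_exact (h : TwoAdicBSDEtaExactRankOneSs) : TwoAdicEtaIsogenyRatioRankOneSs := by
  intro W W' _ _ _ _ hS hS' hgood hgood' hss hss' hr1 hr1' hap N _ f hf hf' L hLL u v u' v' huv huv' P P' hP hP'
    hfin hfin' ϖ ϖ' hϖ hϖ'
  have e1 := h W hS hgood hss hr1 f hf L hLL u v huv P hP hfin ϖ hϖ
  have e2 := h W' hS' hgood' hss' hr1' f hf' L (isSsLDerivVector_congr hap hLL) u' v' huv' P' hP' hfin' ϖ' hϖ'
  rw [ssLeadingEta_eq] at e1 e2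
  have hB : ssLeadingFomega W' 2 L = ssLeadingFomega W 2 L := by
    simp only [ssLeadingFomega, frobMatrixOmegaBasis_congr hap]
  rw [hB] at e2
  linear_combination ((ϖ : ℚ_[2]) * v * (W.torsionOrder : ℚ_[2]) ^ 2) * e2
    - ((ϖ' : ℚ_[2]) * v' * (W'.torsionOrder : ℚ_[2]) ^ 2) * e1

/-- **Glue17Ss (support).** K2-Vss-fin and K2-Tss with the printed inputs GZK, Kolyvagin, modularity, the period ratio, CONVERGENCE of the
`D`-valued Riemann sums, EXISTENCE of the Katz column at a supersingular prime and of a Mordell–Weil basis of size `rank`, give the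
supersingular half of 23715.  (= g7 `Glue16Ss` with K2-Vss replaced by the weaker K2-Vss-fin; so K2-Xss feeds the same chain via `valFin_of_exact`.) -/
def Glue17Ss : Prop :=
  TwoAdicBSDEtaValFinRankOneSs → TwoAdicShaAnTransferEtaRankOneSs →
  (∀ (W : WeierstrassCurve ℚ) [W.IsElliptic], W.analyticRank ≤ 1 → W.mordellWeilRank = W.analyticRank) →
  (∀ (W : WeierstrassCurve ℚ) [W.IsElliptic], W.analyticRank ≤ 1 → Finite W.sha) →
  (∀ (W : WeierstrassCurve ℚ) [W.IsElliptic], ∃ N : ℕ, ∃ _ : NeZero N, ∃ f : CuspForm (Gamma0 N) 2,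
      IsNewformOf W f) →
  (∀ (W : WeierstrassCurve ℚ) [W.IsElliptic] [W.IsGloballyMinimal] ⦃N : ℕ⦄ [NeZero N]
      (f : CuspForm (Gamma0 N) 2), IsNewformOf W f → ∃ ϖ : ℚ, (ϖ : ℝ) * W.realPeriodRat = plusPeriod f) →
  (∀ (W : WeierstrassCurve ℚ) [W.IsElliptic] [W.IsGloballyMinimal] ⦃N : ℕ⦄ [NeZero N]
      (f : CuspForm (Gamma0 N) 2), IsNewformOf W f → W.HasGoodReductionAtPrime 2 → ¬ IsOrdinaryAt W 2 →
      ∃ L : Fin 2 → ℚ_[2], IsSsLDerivVector W 2 f L) →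
  (∀ (W : WeierstrassCurve ℚ) [W.IsElliptic] [W.IsGloballyMinimal], W.HasGoodReductionAtPrime 2 → ¬ IsOrdinaryAt W 2 →
      ∃ u v : ℚ_[2], IsKatzFrobeniusColumn W 2 u v) →
  (∀ (W : WeierstrassCurve ℚ) [W.IsElliptic], W.mordellWeilRank = 1 →
      ∃ P : Fin 1 → W.toAffine.Point, IsMordellWeilBasis P) →
  RankOneAtTwoBigImageOddLocalSs

/-- **`Glue17Ss` (PROVED; logic, casts and `‖·‖₂ ↔ v₂` only).** -/
theorem glue17Ss : Glue17Ss := by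
  intro hV hT hGZK hKoly hMod hPer hL hKatz hMW W _ _ hS hgood hss hr1
  have hle : W.analyticRank ≤ 1 := hr1.le
  haveI hfinSha : Finite W.sha := hKoly W hle
  haveI hfin : Finite (AddCommGroup.primaryComponent W.sha 2) := inferInstance
  have hrk : W.mordellWeilRank = W.analyticRank := hGZK W hle
  refine ⟨hrk, hfin, ?_⟩
  obtain ⟨N, hN, f, hf⟩ := hMod W
  obtain ⟨ϖ, hϖ⟩ := hPer W f hf
  obtain ⟨L, hLL⟩ := hL W f hf hgood hss
  obtain ⟨u, v, huv⟩ := hKatz W hgood hss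
  obtain ⟨P, hP⟩ := hMW W (hrk.trans hr1)
  have h1 := hV W hS hgood hss hr1 f hf L hLL u v huv P hP hfinSha ϖ hϖ
  obtain ⟨hlog, q, hq, h2⟩ := hT W hS hgood hss hr1 f hf L hLL u v huv P hP ϖ hϖ
  refine ⟨q, hq, ?_⟩
  have h3 := h1.symm.trans h2
  have hTam0 : W.tamagawaProduct ≠ 0 := fun h0 ↦ by
    have := hS.2.2.2
    rw [h0] at this
    exact (Nat.not_odd_zero this).elim
  have hTam : (W.tamagawaProduct : ℚ_[2]) ≠ 0 := by exact_mod_cast hTam0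
  have hcard0 : Nat.card (AddCommGroup.primaryComponent W.sha 2) ≠ 0 := Nat.card_pos.ne'
  simp only [norm_mul] at h3
  have hl' : 0 < ‖(logOmegaAt W 2 (P 0)) ^ 2‖ := norm_pos_iff.mpr (pow_ne_zero _ hlog)
  have hT' : 0 < ‖(W.tamagawaProduct : ℚ_[2])‖ := norm_pos_iff.mpr hTam
  have h5 := mul_right_cancel₀ hT'.ne' h3
  have h4 : ‖((Nat.card (AddCommGroup.primaryComponent W.sha 2) : ℕ) : ℚ_[2])‖ = ‖((q : ℚ) : ℚ_[2])‖ :=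
    mul_right_cancel₀ hl'.ne' h5
  exact padicValRat_eq_padicValNat_of_norm_eq hcard0 h4

/-- **The §17 chain to the supersingular half of 23715 (PROVED modulo the named inputs):** K2-Xss in place of K2-Vss. -/
theorem rankOneAtTwoSs_of_exact (hX : TwoAdicBSDEtaExactRankOneSs) (hT : TwoAdicShaAnTransferEtaRankOneSs)
    (hGZK : ∀ (W : WeierstrassCurve ℚ) [W.IsElliptic], W.analyticRank ≤ 1 → W.mordellWeilRank = W.analyticRank)
    (hKoly : ∀ (W : WeierstrassCurve ℚ) [W.IsElliptic], W.analyticRank ≤ 1 → Finite W.sha)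
    (hMod : ∀ (W : WeierstrassCurve ℚ) [W.IsElliptic], ∃ N : ℕ, ∃ _ : NeZero N, ∃ f : CuspForm (Gamma0 N) 2, IsNewformOf W f)
    (hPer : ∀ (W : WeierstrassCurve ℚ) [W.IsElliptic] [W.IsGloballyMinimal] ⦃N : ℕ⦄ [NeZero N]
      (f : CuspForm (Gamma0 N) 2), IsNewformOf W f → ∃ ϖ : ℚ, (ϖ : ℝ) * W.realPeriodRat = plusPeriod f)
    (hL : ∀ (W : WeierstrassCurve ℚ) [W.IsElliptic] [W.IsGloballyMinimal] ⦃N : ℕ⦄ [NeZero N]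
      (f : CuspForm (Gamma0 N) 2), IsNewformOf W f → W.HasGoodReductionAtPrime 2 → ¬ IsOrdinaryAt W 2 →
      ∃ L : Fin 2 → ℚ_[2], IsSsLDerivVector W 2 f L)
    (hKatz : ∀ (W : WeierstrassCurve ℚ) [W.IsElliptic] [W.IsGloballyMinimal], W.HasGoodReductionAtPrime 2 → ¬ IsOrdinaryAt W 2 →
      ∃ u v : ℚ_[2], IsKatzFrobeniusColumn W 2 u v)
    (hMW : ∀ (W : WeierstrassCurve ℚ) [W.IsElliptic], W.mordellWeilRank = 1 → ∃ P : Fin 1 → W.toAffine.Point, IsMordellWeilBasis P) :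
    RankOneAtTwoBigImageOddLocalSs :=
  glue17Ss (valFin_of_exact hX) hT hGZK hKoly hMod hPer hL hKatz hMW

end Summit.BirchSwinnertonDyer.Rank1Residual.F1Sign2
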